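import Summits.KontsevichZagierPeriods.Zeta5Search.Certificates.ModRedLNKSum
import Summits.KontsevichZagierPeriods.Zeta5Search.Certificates.ModRedLK3All
import HarnessLib

/-!
# ζ(5) search — brown9 LEVEL 2: the relation (L-NK) for EVERY rational `k₃` (cell `pub-zeta5`, certifier `cert-1`)

HONEST FRAMING: systematic search; recurrence certificates; no irrationality claim unless certified.

`Certificates/ModRedLNKSum.lean` proved the ttrl2 lane's `n`-shift relation (L-NK) of fam-brown9's triple sum,
`12[μ₁₀L(n+1,x) + μ₀₀L(n,x) + μ₀₁L(n,x+1) + μ₀₂L(n,x+2)] = 0`, for `n ≥ 6` and NON-INTEGRAL rational `x` (the module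
reduction divides by linear forms that vanish only at integers). As for (R-NK) and (L-K3) (`ModRedNKAll`, `ModRedLK3All`,
cert-2), the gap is closed by POLYNOMIALITY: the left-hand side is a polynomial function of `x` (`PolyRep`) vanishing on
the infinite set of non-integers, hence everywhere: `L_rel_NK_all (n ≥ 6) (x : ℚ)`. No named facts.
-/

noncomputable section

namespace Summit.KontsevichZagierPeriods.Zeta5Search.Certificates

namespace VIMInner.ModRed

open Finset Polynomial
open Summit.KontsevichZagierPeriods.Zeta5Search.PolyReflect

/-- The (L-NK) combination as a polynomially represented function of `x`. -/
def polyRep_LNK (n : ℕ) :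
    PolyRep fun x => ev2 etaM10 n x * Lsum (n + 1) x + ev2 etaM00 n x * Lsum n x + ev2 etaM01 n x * Lsum n (x + 1)
      + ev2 etaM02 n x * Lsum n (x + 2) := by
  have h0 : PolyRep fun x => Lsum n x := by
    have h := polyRep_Lsum n 0
    exact ⟨h.poly, fun x => by rw [← add_zero x, h.eval_eq x, add_zero]⟩
  have h1 : PolyRep fun x => Lsum (n + 1) x := by
    have h := polyRep_Lsum (n + 1) 0
    exact ⟨h.poly, fun x => by rw [← add_zero x, h.eval_eq x, add_zero]⟩
  exact ((((polyRep_ev2 n etaM10).mul h1).add ((polyRep_ev2 n etaM00).mul h0)).add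
    ((polyRep_ev2 n etaM01).mul (polyRep_Lsum n 1))).add ((polyRep_ev2 n etaM02).mul (polyRep_Lsum n 2))

/-- **(L-NK), all `x`**: for `n ≥ 6` and EVERY rational `x` (in particular every integer `k₃`),
`12[μ₁₀(n,x)L(n+1,x) + μ₀₀(n,x)L(n,x) + μ₀₁(n,x)L(n,x+1) + μ₀₂(n,x)L(n,x+2)] = 0` — the ttrl2 lane's `n`-shift relation of
fam-brown9's triple sum `L` ("vanishing in the middle" leading coefficient), `12μ_ij = ev2 etaM··` (integer data). -/
theorem L_rel_NK_all (n : ℕ) (hn : 6 ≤ n) (x : ℚ) :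
    ev2 etaM10 n x * Lsum (n + 1) x + ev2 etaM00 n x * Lsum n x + ev2 etaM01 n x * Lsum n (x + 1)
      + ev2 etaM02 n x * Lsum n (x + 2) = 0 :=
  PolyRep.eq_zero_of_not_int (polyRep_LNK n) (fun y hy => L_rel_NK n hn y hy) x

end VIMInner.ModRed

end Summit.KontsevichZagierPeriods.Zeta5Search.Certificates
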